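import Mathlib
import HarnessLib
import Summits.Ventures.LatticeQCDFlow.Scoring.BatchMeansCLTDecomposition
import Summits.Ventures.LatticeQCDFlow.Scoring.BatchMeansCLTBoundary
import Summits.Ventures.LatticeQCDFlow.Scoring.GeometricEnvelopeBlockSumMoments

/-!
# The remainder of the batch-means estimator at the CLT scale is small in `L¹`, from any start:
# `E_{μ₀} |√a (σ̂²_{a,b} − π(q)) − (Σ_j (M_{bj,b}² − Σ_i q(X_{bj+i})))/(√a b)|`
# `≤ K₁/√b + K₂ √a/b + 20 C_h² √a/(a−1)`

HONEST FRAMING: exact (Metropolis-corrected) sampling algorithms for lattice gauge theory;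
figures of merit are autocorrelation/cost numbers at stated couplings and volumes; no
continuum-physics claim.

Venture `LatticeQCDFlow` (cell pub-lqcd), topic `Scoring`; FANOUT row 4 (`s0-u1-b`, GEN-30).
NEW WORK of the cell, not a published result; no definition is introduced; nothing is cited as a
fact.  Setting: row 8's geometric envelope `(A, ρ)` (`0 ≤ A`, `0 ≤ ρ < 1`), `|f| ≤ C` measurable,
`h` a bounded measurable solution of the Poisson equation `h − kop κ h = f − πf` (`|h| ≤ C_h`),
`q = kop κ (h²) − (kop κ h)²`, `P_{μ₀}` the chain's path law from ANY initial law, `a ≥ 2` batches of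
length `b ≥ 1`, `σ̂²_{a,b} = ab · SE²_BM` the batch-means estimator.  The pathwise decomposition of
`Scoring/BatchMeansCLTDecomposition.lean` writes `√a (σ̂² − π(q))` as the centred squared block
martingales (asymptotically `N(0, 2σ⁴)`, `Scoring/BatchMeansMartingaleCLT.lean`) plus seven
remainders; here each is bounded in `L¹(P_{μ₀})` UNIFORMLY IN THE INITIAL LAW: the compensator
fluctuation `(Σ_{t<ab}(q(X_t) − πq))/(√a b)` by the block-sum second moment under the envelope
(`≤ √10 K_q/√b`, `K_q = 4 C_h² A/(1−ρ)`); the start and centred end boundary terms by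
`Scoring/BatchMeansCLTBoundary.lean` (`≤ 2C_h²/√b`, `≤ 4C_h²/√b`); the conditional means of the end
term (`≤ 2 K_q √a/b`) and the squared boundary (`≤ 4 C_h² √a/b`) surely; the two centring terms by
the second moments of block sums (`≤ 10 C_h² √a/(a−1)` each).

## Content

* **`chain_batchMeans_scaled_sub_martingalePart_integral_abs_le_of_envelope`** — for every `μ₀`,
  `a ≥ 2`, `b ≥ 1`: `E_{μ₀} |√a (ab · SE²_BM − π(q)) − (Σ_{j<a} (M_{bj,b}² − Σ_{i<b} q(X_{bj+i})))/(√a b)|`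
  `≤ (√10 K_q + 6 C_h²)/√b + (2 K_q + 4 C_h²) √a/b + 20 C_h² √a/(a − 1)`.

NOT CLAIMED: sharp constants; unbounded observables.
-/

noncomputable section

namespace Summit.Ventures.LatticeQCDFlow.Scoring

open MeasureTheory ProbabilityTheory Filter Finset Preorder
open scoped ENNReal Topology

variable {Ω : Type*} [MeasurableSpace Ω]

section Envelope

variable {κ : Kernel Ω Ω} [IsMarkovKernel κ] {π : Measure Ω} [IsProbabilityMeasure π] {A ρ : ℝ}

/-- **THE `L¹` BOUND OF THE REMAINDER, FROM ANY START** (see the module docstring). -/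
theorem chain_batchMeans_scaled_sub_martingalePart_integral_abs_le_of_envelope
    (henv : ∀ (g : Ω → ℝ), Measurable g → ∀ (Cg : ℝ), (∀ x, |g x| ≤ Cg) →
      ∀ (t : ℕ) (x : Ω), |(kop κ)^[t] g x - ∫ y, g y ∂π| ≤ 2 * Cg * (A * ρ ^ t))
    (hA : 0 ≤ A) (hρ0 : 0 ≤ ρ) (hρ1 : ρ < 1)
    {f : Ω → ℝ} (hf : Measurable f) {C : ℝ} (hC : ∀ x, |f x| ≤ C)
    {h : Ω → ℝ} (hh : Measurable h) {Ch : ℝ} (hCh : ∀ x, |h x| ≤ Ch)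
    (hpois : ∀ y, h y - kop κ h y = f y - ∫ z, f z ∂π)
    (μ₀ : Measure Ω) [IsProbabilityMeasure μ₀] {a b : ℕ} (ha : 2 ≤ a) (hb : b ≠ 0) :
    ∫ x, |Real.sqrt a * (((b * a : ℕ) : ℝ) * replicaSEsq (fun j (x : ℕ → Ω) =>
          (∑ i ∈ Finset.range b, f (x (b * j + i))) / b) a x - ∫ y, (kop κ (fun y => h y ^ 2) y - (kop κ h y) ^ 2) ∂π)
        - (∑ j ∈ Finset.range a, ((∑ r ∈ Finset.range b, (h (x (b * j + r + 1)) - kop κ h (x (b * j + r)))) ^ 2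
            - ∑ i ∈ Finset.range b, (kop κ (fun y => h y ^ 2) (x (b * j + i)) - (kop κ h (x (b * j + i))) ^ 2))) / (Real.sqrt a * b)| ∂(Kernel.trajMeasure (X := fun _ : ℕ => Ω) (μ₀)
                  (fun n : ℕ => κ.comap (fun h' : (i : ↥(Finset.Iic n)) → Ω => h' ⟨n, Finset.mem_Iic.2 le_rfl⟩)
                    (measurable_pi_apply _)))
      ≤ (Real.sqrt 10 * (4 * Ch ^ 2 * A / (1 - ρ)) + 6 * Ch ^ 2) / Real.sqrt b
        + (2 * (4 * Ch ^ 2 * A / (1 - ρ)) + 4 * Ch ^ 2) * Real.sqrt a / b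
        + 20 * Ch ^ 2 * Real.sqrt a / ((a : ℝ) - 1) := by
  set P := (Kernel.trajMeasure (X := fun _ : ℕ => Ω) (μ₀)
        (fun n : ℕ => κ.comap (fun h' : (i : ↥(Finset.Iic n)) → Ω => h' ⟨n, Finset.mem_Iic.2 le_rfl⟩)
          (measurable_pi_apply _))) with hP
  set m : ℝ := ∫ y, (kop κ (fun y => h y ^ 2) y - (kop κ h y) ^ 2) ∂π with hm
  set c : ℝ := ∫ z, f z ∂π with hc
  set Kq : ℝ := 4 * Ch ^ 2 * A / (1 - ρ) with hKq
  have h1ρ : 0 < 1 - ρ := sub_pos.2 hρ1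
  have hC0 : 0 ≤ Ch := (abs_nonneg _).trans (hCh (Classical.choice
    (nonempty_of_isProbabilityMeasure μ₀)))
  have hKq0 : 0 ≤ Kq := by positivity
  have ha2 : (2 : ℝ) ≤ a := by exact_mod_cast ha
  have haR : (0 : ℝ) < a := by linarith
  have ha1 : (0 : ℝ) < (a : ℝ) - 1 := by linarith
  have hbR : (0 : ℝ) < b := Nat.cast_pos.2 (Nat.pos_of_ne_zero hb)
  have hs0 : 0 < Real.sqrt a := Real.sqrt_pos.2 haR
  have hss : Real.sqrt a * Real.sqrt a = a := Real.mul_self_sqrt haR.le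
  have hss2 : Real.sqrt a ^ 2 = (a : ℝ) := by rw [sq]; exact hss
  have hsb : 0 < Real.sqrt a * b := mul_pos hs0 hbR
  have hsqb : 0 < Real.sqrt b := Real.sqrt_pos.2 hbR
  obtain ⟨hqm, hqb⟩ := kopCondVar_bounded_measurable κ hh hCh
  obtain ⟨hfbm, hfbb, -⟩ := centred_observable_bounds π hf hC
  have hqc : ∀ z, |(kop κ (fun y => h y ^ 2) z - (kop κ h z) ^ 2) - m| ≤ 2 * Ch ^ 2 := (centred_observable_bounds π hqm hqb).2.1
  -- the conditional mean of the end term and its bound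
  set φ : Ω → ℝ := fun z => ∫ y, (∑ r ∈ Finset.range b, (h (y (0 + r + 1)) - kop κ h (y (0 + r)))) * h (y b) ∂(Kernel.trajMeasure (X := fun _ : ℕ => Ω) (Measure.dirac z)
        (fun n : ℕ => κ.comap (fun h' : (i : ↥(Finset.Iic n)) → Ω => h' ⟨n, Finset.mem_Iic.2 le_rfl⟩)
          (measurable_pi_apply _))) with hφ
  have hΨm : Measurable fun y : ℕ → Ω => (∑ r ∈ Finset.range b, (h (y (0 + r + 1)) - kop κ h (y (0 + r)))) * h (y b) :=
    (blockMartingale_measurable κ hh 0 b).mul (hh.comp (measurable_pi_apply _))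
  have hφm : Measurable φ := measurable_chain_dirac_integral κ hΨm
  have hφb : ∀ z, |φ z| ≤ Kq := fun z =>
    abs_chain_dirac_blockMartingale_mul_end_le_of_envelope henv hA hρ0 hρ1 hh hCh z b
  -- the decomposition
  have hdec := fun x : ℕ → Ω =>
    batchMeans_scaled_sub_martingalePart_eq κ f c m hpois φ ha hb x
  -- Jensen: `∫ |X| ≤ √(∫ X²)` for bounded measurable `X`
  have hJ : ∀ {X : (ℕ → Ω) → ℝ}, Measurable X → ∀ {CX : ℝ}, (∀ x, |X x| ≤ CX) →
      ∫ x, |X x| ∂P ≤ Real.sqrt (∫ x, X x ^ 2 ∂P) := by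
    intro X hX CX hXb
    have h1 := sq_integral_le_integral_sq P hX.abs (C := CX) (fun x => by rw [abs_abs]; exact hXb x)
    simp only [sq_abs] at h1
    exact (Real.le_sqrt (integral_nonneg fun x => abs_nonneg _)
      (integral_nonneg fun x => sq_nonneg _)).2 h1
  have hMm : ∀ j, Measurable fun x : ℕ → Ω => (∑ r ∈ Finset.range b, (h (x (b * j + r + 1)) - kop κ h (x (b * j + r)))) := fun j =>
    blockMartingale_measurable κ hh _ _
  have hMb : ∀ j (x : ℕ → Ω), |(∑ r ∈ Finset.range b, (h (x (b * j + r + 1)) - kop κ h (x (b * j + r))))| ≤ b * (2 * Ch) := fun j x =>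
    abs_blockMartingale_le κ hCh _ _ x
  -- (T1) the compensator fluctuation
  have hT1m : Measurable fun x : ℕ → Ω => (∑ t ∈ Finset.range (b * a), ((kop κ (fun y => h y ^ 2) (x t) - (kop κ h (x t)) ^ 2) - m)) / (Real.sqrt a * b) :=
    (Finset.measurable_sum _ fun t _ => (hqm.comp (measurable_pi_apply _)).sub_const _).div_const _
  have hT1b : ∀ x : ℕ → Ω, |(∑ t ∈ Finset.range (b * a), ((kop κ (fun y => h y ^ 2) (x t) - (kop κ h (x t)) ^ 2) - m)) / (Real.sqrt a * b)| ≤ (b * a : ℕ) * (2 * Ch ^ 2) / (Real.sqrt a * b) := fun x => by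
    rw [abs_div, abs_of_pos hsb]
    refine div_le_div_of_nonneg_right ((Finset.abs_sum_le_sum_abs _ _).trans ?_) hsb.le
    calc ∑ t ∈ Finset.range (b * a), |(kop κ (fun y => h y ^ 2) (x t) - (kop κ h (x t)) ^ 2) - m| ≤ ∑ _t ∈ Finset.range (b * a), 2 * Ch ^ 2 :=
          Finset.sum_le_sum fun t _ => hqc _
      _ = (b * a : ℕ) * (2 * Ch ^ 2) := by rw [Finset.sum_const, Finset.card_range, nsmul_eq_mul]
  have hT1 : ∫ x, |(∑ t ∈ Finset.range (b * a), ((kop κ (fun y => h y ^ 2) (x t) - (kop κ h (x t)) ^ 2) - m)) / (Real.sqrt a * b)| ∂P ≤ Real.sqrt 10 * Kq / Real.sqrt b := by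
    refine (hJ hT1m hT1b).trans ?_
    have h2 := chain_blockSum_sq_le_of_envelope (κ := κ) henv hρ0 hρ1 hqm hqb μ₀ 0
      (n := b * a) (Nat.mul_ne_zero hb (by omega))
    rw [← hP] at h2
    simp only [zero_add] at h2
    rw [← hm, ← hKq] at h2
    push_cast at h2
    have h3 : ∫ x, ((∑ t ∈ Finset.range (b * a), ((kop κ (fun y => h y ^ 2) (x t) - (kop κ h (x t)) ^ 2) - m)) / (Real.sqrt a * b)) ^ 2 ∂P ≤ 10 * Kq ^ 2 / b := by
      simp_rw [div_pow]
      rw [integral_div, mul_pow, hss2, div_le_div_iff₀ (by positivity) hbR]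
      have := mul_le_mul_of_nonneg_right h2 hbR.le
      nlinarith [this]
    calc Real.sqrt (∫ x, ((∑ t ∈ Finset.range (b * a), ((kop κ (fun y => h y ^ 2) (x t) - (kop κ h (x t)) ^ 2) - m)) / (Real.sqrt a * b)) ^ 2 ∂P) ≤ Real.sqrt (10 * Kq ^ 2 / b) := Real.sqrt_le_sqrt h3
      _ = Real.sqrt 10 * Kq / Real.sqrt b := by
          rw [Real.sqrt_div (by positivity), Real.sqrt_mul (by norm_num), Real.sqrt_sq hKq0]
  -- (T2) the start boundary term
  have hT2m : Measurable fun x : ℕ → Ω => 2 * (∑ j ∈ Finset.range a, (∑ r ∈ Finset.range b, (h (x (b * j + r + 1)) - kop κ h (x (b * j + r)))) * h (x (b * j))) / (Real.sqrt a * b) :=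
    ((Finset.measurable_sum _ fun j _ => (hMm j).mul (hh.comp (measurable_pi_apply _))).const_mul
      _).div_const _
  have hT2b : ∀ x : ℕ → Ω, |2 * (∑ j ∈ Finset.range a, (∑ r ∈ Finset.range b, (h (x (b * j + r + 1)) - kop κ h (x (b * j + r)))) * h (x (b * j))) / (Real.sqrt a * b)| ≤ 2 * (a * (b * (2 * Ch) * Ch)) / (Real.sqrt a * b) := fun x => by
    rw [abs_div, abs_of_pos hsb, abs_mul, abs_two]
    refine div_le_div_of_nonneg_right (mul_le_mul_of_nonneg_left
      ((Finset.abs_sum_le_sum_abs _ _).trans ?_) zero_le_two) hsb.le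
    calc ∑ j ∈ Finset.range a, |(∑ r ∈ Finset.range b, (h (x (b * j + r + 1)) - kop κ h (x (b * j + r)))) * h (x (b * j))|
        ≤ ∑ _j ∈ Finset.range a, b * (2 * Ch) * Ch := Finset.sum_le_sum fun j _ => by
          rw [abs_mul]; exact mul_le_mul (hMb j x) (hCh _) (abs_nonneg _) (by positivity)
      _ = a * (b * (2 * Ch) * Ch) := by rw [Finset.sum_const, Finset.card_range, nsmul_eq_mul]
  have hT2 : ∫ x, |2 * (∑ j ∈ Finset.range a, (∑ r ∈ Finset.range b, (h (x (b * j + r + 1)) - kop κ h (x (b * j + r)))) * h (x (b * j))) / (Real.sqrt a * b)| ∂P ≤ 2 * Ch ^ 2 / Real.sqrt b := by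
    refine (hJ hT2m hT2b).trans ?_
    have h2 := chain_sum_blockMartingale_mul_start_sq_le κ μ₀ hh hCh a b
    rw [← hP] at h2
    have h3 : ∫ x, (2 * (∑ j ∈ Finset.range a, (∑ r ∈ Finset.range b, (h (x (b * j + r + 1)) - kop κ h (x (b * j + r)))) * h (x (b * j))) / (Real.sqrt a * b)) ^ 2 ∂P ≤ (2 * Ch ^ 2) ^ 2 / b := by
      simp_rw [div_pow, mul_pow]
      rw [integral_div, integral_const_mul, hss2, div_le_div_iff₀ (by positivity) hbR]
      have := mul_le_mul_of_nonneg_right h2 hbR.le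
      nlinarith [this]
    calc Real.sqrt (∫ x, (2 * (∑ j ∈ Finset.range a, (∑ r ∈ Finset.range b, (h (x (b * j + r + 1)) - kop κ h (x (b * j + r)))) * h (x (b * j))) / (Real.sqrt a * b)) ^ 2 ∂P) ≤ Real.sqrt ((2 * Ch ^ 2) ^ 2 / b) := Real.sqrt_le_sqrt h3
      _ = 2 * Ch ^ 2 / Real.sqrt b := by
          rw [Real.sqrt_div (by positivity), Real.sqrt_sq (by positivity)]
  -- (T3) the centred end boundary term
  have hT3m : Measurable fun x : ℕ → Ω => 2 * (∑ j ∈ Finset.range a, ((∑ r ∈ Finset.range b, (h (x (b * j + r + 1)) - kop κ h (x (b * j + r)))) * h (x (b * j + b)) - φ (x (b * j)))) / (Real.sqrt a * b) :=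
    ((Finset.measurable_sum _ fun j _ => ((hMm j).mul (hh.comp (measurable_pi_apply _))).sub
      (hφm.comp (measurable_pi_apply _))).const_mul _).div_const _
  have hT3b : ∀ x : ℕ → Ω, |2 * (∑ j ∈ Finset.range a, ((∑ r ∈ Finset.range b, (h (x (b * j + r + 1)) - kop κ h (x (b * j + r)))) * h (x (b * j + b)) - φ (x (b * j)))) / (Real.sqrt a * b)| ≤ 2 * (a * (b * (2 * Ch) * Ch + Kq)) / (Real.sqrt a * b) := fun x => by
    rw [abs_div, abs_of_pos hsb, abs_mul, abs_two]
    refine div_le_div_of_nonneg_right (mul_le_mul_of_nonneg_left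
      ((Finset.abs_sum_le_sum_abs _ _).trans ?_) zero_le_two) hsb.le
    calc ∑ j ∈ Finset.range a, |(∑ r ∈ Finset.range b, (h (x (b * j + r + 1)) - kop κ h (x (b * j + r)))) * h (x (b * j + b)) - φ (x (b * j))|
        ≤ ∑ _j ∈ Finset.range a, (b * (2 * Ch) * Ch + Kq) := Finset.sum_le_sum fun j _ =>
          (abs_sub _ _).trans (add_le_add (by
            rw [abs_mul]; exact mul_le_mul (hMb j x) (hCh _) (abs_nonneg _) (by positivity))
            (hφb _))
      _ = a * (b * (2 * Ch) * Ch + Kq) := by rw [Finset.sum_const, Finset.card_range, nsmul_eq_mul]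
  have hT3 : ∫ x, |2 * (∑ j ∈ Finset.range a, ((∑ r ∈ Finset.range b, (h (x (b * j + r + 1)) - kop κ h (x (b * j + r)))) * h (x (b * j + b)) - φ (x (b * j)))) / (Real.sqrt a * b)| ∂P ≤ 4 * Ch ^ 2 / Real.sqrt b := by
    refine (hJ hT3m hT3b).trans ?_
    have h2 := chain_sum_blockMartingale_mul_end_centred_sq_le κ μ₀ hh hCh a b
    rw [← hP] at h2
    have h3 : ∫ x, (2 * (∑ j ∈ Finset.range a, ((∑ r ∈ Finset.range b, (h (x (b * j + r + 1)) - kop κ h (x (b * j + r)))) * h (x (b * j + b)) - φ (x (b * j)))) / (Real.sqrt a * b)) ^ 2 ∂P ≤ (4 * Ch ^ 2) ^ 2 / b := by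
      simp_rw [div_pow, mul_pow]
      rw [integral_div, integral_const_mul, hss2, div_le_div_iff₀ (by positivity) hbR]
      have := mul_le_mul_of_nonneg_right h2 hbR.le
      nlinarith [this]
    calc Real.sqrt (∫ x, (2 * (∑ j ∈ Finset.range a, ((∑ r ∈ Finset.range b, (h (x (b * j + r + 1)) - kop κ h (x (b * j + r)))) * h (x (b * j + b)) - φ (x (b * j)))) / (Real.sqrt a * b)) ^ 2 ∂P) ≤ Real.sqrt ((4 * Ch ^ 2) ^ 2 / b) := Real.sqrt_le_sqrt h3
      _ = 4 * Ch ^ 2 / Real.sqrt b := by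
          rw [Real.sqrt_div (by positivity), Real.sqrt_sq (by positivity)]
  -- (T4) the conditional means, surely
  have hT4m : Measurable fun x : ℕ → Ω => 2 * (∑ j ∈ Finset.range a, φ (x (b * j))) / (Real.sqrt a * b) :=
    ((Finset.measurable_sum _ fun j _ => hφm.comp (measurable_pi_apply _)).const_mul _).div_const _
  have hT4b : ∀ x : ℕ → Ω, |2 * (∑ j ∈ Finset.range a, φ (x (b * j))) / (Real.sqrt a * b)| ≤ 2 * Kq * Real.sqrt a / b := fun x => by
    rw [abs_div, abs_of_pos hsb, abs_mul, abs_two]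
    have h1 : |∑ j ∈ Finset.range a, φ (x (b * j))| ≤ a * Kq :=
      (Finset.abs_sum_le_sum_abs _ _).trans (by
        calc ∑ j ∈ Finset.range a, |φ (x (b * j))| ≤ ∑ _j ∈ Finset.range a, Kq :=
            Finset.sum_le_sum fun j _ => hφb _
          _ = a * Kq := by rw [Finset.sum_const, Finset.card_range, nsmul_eq_mul])
    rw [div_le_div_iff₀ hsb hbR]
    calc 2 * |∑ j ∈ Finset.range a, φ (x (b * j))| * b ≤ 2 * (a * Kq) * b := by gcongr
      _ = 2 * Kq * Real.sqrt a * (Real.sqrt a * b) := by linear_combination (-(2 * Kq * (b : ℝ))) * hss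
  have hT4 : ∫ x, |2 * (∑ j ∈ Finset.range a, φ (x (b * j))) / (Real.sqrt a * b)| ∂P ≤ 2 * Kq * Real.sqrt a / b := by
    calc ∫ x, |2 * (∑ j ∈ Finset.range a, φ (x (b * j))) / (Real.sqrt a * b)| ∂P ≤ ∫ _x, 2 * Kq * Real.sqrt a / b ∂P :=
          integral_mono (integrable_of_bounded P hT4m hT4b).abs (integrable_const _) hT4b
      _ = 2 * Kq * Real.sqrt a / b := by rw [integral_const, probReal_univ, one_smul]
  -- (T5) the squared boundary, surely
  have hT5m : Measurable fun x : ℕ → Ω => (∑ j ∈ Finset.range a, (h (x (b * j)) - h (x (b * j + b))) ^ 2) / (Real.sqrt a * b) :=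
    (Finset.measurable_sum _ fun j _ => ((hh.comp (measurable_pi_apply _)).sub
      (hh.comp (measurable_pi_apply _))).pow_const 2).div_const _
  have hT5b : ∀ x : ℕ → Ω, |(∑ j ∈ Finset.range a, (h (x (b * j)) - h (x (b * j + b))) ^ 2) / (Real.sqrt a * b)| ≤ 4 * Ch ^ 2 * Real.sqrt a / b := fun x => by
    rw [abs_div, abs_of_pos hsb, abs_of_nonneg (Finset.sum_nonneg fun j _ => sq_nonneg _),
      div_le_div_iff₀ hsb hbR]
    have h1 : ∑ j ∈ Finset.range a, (h (x (b * j)) - h (x (b * j + b))) ^ 2 ≤ a * (2 * Ch) ^ 2 := by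
      calc ∑ j ∈ Finset.range a, (h (x (b * j)) - h (x (b * j + b))) ^ 2
          ≤ ∑ _j ∈ Finset.range a, (2 * Ch) ^ 2 := Finset.sum_le_sum fun j _ => by
            have hd : |h (x (b * j)) - h (x (b * j + b))| ≤ 2 * Ch :=
              (abs_sub _ _).trans (by linarith [hCh (x (b * j)), hCh (x (b * j + b))])
            rw [← sq_abs]; exact pow_le_pow_left₀ (abs_nonneg _) hd 2
        _ = a * (2 * Ch) ^ 2 := by rw [Finset.sum_const, Finset.card_range, nsmul_eq_mul]
    calc (∑ j ∈ Finset.range a, (h (x (b * j)) - h (x (b * j + b))) ^ 2) * b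
        ≤ a * (2 * Ch) ^ 2 * b := by gcongr
      _ = 4 * Ch ^ 2 * Real.sqrt a * (Real.sqrt a * b) := by
          linear_combination (-(4 * Ch ^ 2 * (b : ℝ))) * hss
  have hT5 : ∫ x, |(∑ j ∈ Finset.range a, (h (x (b * j)) - h (x (b * j + b))) ^ 2) / (Real.sqrt a * b)| ∂P ≤ 4 * Ch ^ 2 * Real.sqrt a / b := by
    calc ∫ x, |(∑ j ∈ Finset.range a, (h (x (b * j)) - h (x (b * j + b))) ^ 2) / (Real.sqrt a * b)| ∂P ≤ ∫ _x, 4 * Ch ^ 2 * Real.sqrt a / b ∂P :=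
          integral_mono (integrable_of_bounded P hT5m hT5b).abs (integrable_const _) hT5b
      _ = 4 * Ch ^ 2 * Real.sqrt a / b := by rw [integral_const, probReal_univ, one_smul]
  -- (T6) the first centring term
  have hSm : ∀ j, Measurable fun x : ℕ → Ω => ∑ i ∈ Finset.range b, (f (x (b * j + i)) - c) := fun j =>
    Finset.measurable_sum _ fun i _ => hfbm.comp (measurable_pi_apply _)
  have hSb : ∀ j (x : ℕ → Ω), |∑ i ∈ Finset.range b, (f (x (b * j + i)) - c)| ≤ b * (2 * C) :=
    fun j x => (Finset.abs_sum_le_sum_abs _ _).trans (by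
      calc ∑ i ∈ Finset.range b, |f (x (b * j + i)) - c| ≤ ∑ _i ∈ Finset.range b, 2 * C :=
          Finset.sum_le_sum fun i _ => hfbb _
        _ = b * (2 * C) := by rw [Finset.sum_const, Finset.card_range, nsmul_eq_mul])
  have hT6m : Measurable fun x : ℕ → Ω => Real.sqrt a / ((a : ℝ) - 1) * ((∑ j ∈ Finset.range a, (∑ i ∈ Finset.range b, (f (x (b * j + i)) - c)) ^ 2) / b / a) :=
    (((Finset.measurable_sum _ fun j _ => (hSm j).pow_const 2).div_const _).div_const _).const_mul _
  have hT6nn : ∀ x : ℕ → Ω, 0 ≤ Real.sqrt a / ((a : ℝ) - 1) * ((∑ j ∈ Finset.range a, (∑ i ∈ Finset.range b, (f (x (b * j + i)) - c)) ^ 2) / b / a) :=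
    fun x => mul_nonneg (div_nonneg hs0.le ha1.le) (div_nonneg (div_nonneg
      (Finset.sum_nonneg fun j _ => sq_nonneg _) hbR.le) haR.le)
  have hT6b : ∀ x : ℕ → Ω, |Real.sqrt a / ((a : ℝ) - 1) * ((∑ j ∈ Finset.range a, (∑ i ∈ Finset.range b, (f (x (b * j + i)) - c)) ^ 2) / b / a)| ≤ Real.sqrt a / ((a : ℝ) - 1) * (a * (b * (2 * C)) ^ 2 / b / a) := fun x => by
    rw [abs_of_nonneg (hT6nn x)]
    refine mul_le_mul_of_nonneg_left (div_le_div_of_nonneg_right (div_le_div_of_nonneg_right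
      ?_ hbR.le) haR.le) (div_nonneg hs0.le ha1.le)
    calc ∑ j ∈ Finset.range a, (∑ i ∈ Finset.range b, (f (x (b * j + i)) - c)) ^ 2
        ≤ ∑ _j ∈ Finset.range a, (b * (2 * C)) ^ 2 := Finset.sum_le_sum fun j _ => by
          rw [← sq_abs]; exact pow_le_pow_left₀ (abs_nonneg _) (hSb j x) 2
      _ = a * (b * (2 * C)) ^ 2 := by rw [Finset.sum_const, Finset.card_range, nsmul_eq_mul]
  have hS2 : ∀ j, ∫ x, (∑ i ∈ Finset.range b, (f (x (b * j + i)) - c)) ^ 2 ∂P ≤ 10 * Ch ^ 2 * b := by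
    intro j
    have := chain_blockSum_sq_le_of_poisson κ μ₀ hh hCh hfbm hpois (b * j) hb
    rwa [← hP] at this
  have hT6 : ∫ x, |Real.sqrt a / ((a : ℝ) - 1) * ((∑ j ∈ Finset.range a, (∑ i ∈ Finset.range b, (f (x (b * j + i)) - c)) ^ 2) / b / a)| ∂P ≤ 10 * Ch ^ 2 * Real.sqrt a / ((a : ℝ) - 1) := by
    rw [integral_congr_ae (ae_of_all _ fun x => abs_of_nonneg (hT6nn x))]
    rw [integral_const_mul, integral_div, integral_div,
      integral_finsetSum _ (fun j _ => integrable_of_bounded P ((hSm j).pow_const 2)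
        (C := (b * (2 * C)) ^ 2) fun x => by
          rw [abs_pow]; exact pow_le_pow_left₀ (abs_nonneg _) (hSb j x) 2)]
    have h1 : ∑ j ∈ Finset.range a, ∫ x, (∑ i ∈ Finset.range b, (f (x (b * j + i)) - c)) ^ 2 ∂P
        ≤ a * (10 * Ch ^ 2 * b) := by
      calc ∑ j ∈ Finset.range a, ∫ x, (∑ i ∈ Finset.range b, (f (x (b * j + i)) - c)) ^ 2 ∂P
          ≤ ∑ _j ∈ Finset.range a, 10 * Ch ^ 2 * b := Finset.sum_le_sum fun j _ => hS2 j
        _ = a * (10 * Ch ^ 2 * b) := by rw [Finset.sum_const, Finset.card_range, nsmul_eq_mul]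
    calc Real.sqrt a / ((a : ℝ) - 1) * ((∑ j ∈ Finset.range a,
          ∫ x, (∑ i ∈ Finset.range b, (f (x (b * j + i)) - c)) ^ 2 ∂P) / b / a)
        ≤ Real.sqrt a / ((a : ℝ) - 1) * (a * (10 * Ch ^ 2 * b) / b / a) := by gcongr
      _ = 10 * Ch ^ 2 * Real.sqrt a / ((a : ℝ) - 1) := by field_simp
  -- (T7) the second centring term
  have hTm' : Measurable fun x : ℕ → Ω => ∑ t ∈ Finset.range (b * a), (f (x t) - c) :=
    Finset.measurable_sum _ fun t _ => hfbm.comp (measurable_pi_apply _)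
  have hTb' : ∀ x : ℕ → Ω, |∑ t ∈ Finset.range (b * a), (f (x t) - c)| ≤ (b * a : ℕ) * (2 * C) :=
    fun x => (Finset.abs_sum_le_sum_abs _ _).trans (by
      calc ∑ t ∈ Finset.range (b * a), |f (x t) - c| ≤ ∑ _t ∈ Finset.range (b * a), 2 * C :=
          Finset.sum_le_sum fun t _ => hfbb _
        _ = (b * a : ℕ) * (2 * C) := by rw [Finset.sum_const, Finset.card_range, nsmul_eq_mul])
  have hT7m : Measurable fun x : ℕ → Ω => Real.sqrt a * a / ((a : ℝ) - 1) * ((∑ t ∈ Finset.range (b * a), (f (x t) - c)) ^ 2 / ((b : ℝ) * (a : ℝ) ^ 2)) :=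
    ((hTm'.pow_const 2).div_const _).const_mul _
  have hT7nn : ∀ x : ℕ → Ω, 0 ≤ Real.sqrt a * a / ((a : ℝ) - 1) * ((∑ t ∈ Finset.range (b * a), (f (x t) - c)) ^ 2 / ((b : ℝ) * (a : ℝ) ^ 2)) :=
    fun x => mul_nonneg (div_nonneg (mul_nonneg hs0.le haR.le) ha1.le)
      (div_nonneg (sq_nonneg _) (by positivity))
  have hT7b : ∀ x : ℕ → Ω, |Real.sqrt a * a / ((a : ℝ) - 1) * ((∑ t ∈ Finset.range (b * a), (f (x t) - c)) ^ 2 / ((b : ℝ) * (a : ℝ) ^ 2))|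
      ≤ Real.sqrt a * a / ((a : ℝ) - 1) * (((b * a : ℕ) * (2 * C)) ^ 2 / ((b : ℝ) * (a : ℝ) ^ 2)) := fun x => by
    rw [abs_of_nonneg (hT7nn x)]
    refine mul_le_mul_of_nonneg_left (div_le_div_of_nonneg_right ?_ (by positivity))
      (div_nonneg (mul_nonneg hs0.le haR.le) ha1.le)
    rw [← sq_abs]; exact pow_le_pow_left₀ (abs_nonneg _) (hTb' x) 2
  have hT2' : ∫ x, (∑ t ∈ Finset.range (b * a), (f (x t) - c)) ^ 2 ∂P ≤ 10 * Ch ^ 2 * (b * a : ℕ) := by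
    have := chain_blockSum_sq_le_of_poisson κ μ₀ hh hCh hfbm hpois 0 (n := b * a)
      (Nat.mul_ne_zero hb (by omega))
    rw [← hP] at this
    simpa only [zero_add] using this
  have hT7 : ∫ x, |Real.sqrt a * a / ((a : ℝ) - 1) * ((∑ t ∈ Finset.range (b * a), (f (x t) - c)) ^ 2 / ((b : ℝ) * (a : ℝ) ^ 2))| ∂P ≤ 10 * Ch ^ 2 * Real.sqrt a / ((a : ℝ) - 1) := by
    rw [integral_congr_ae (ae_of_all _ fun x => abs_of_nonneg (hT7nn x))]
    rw [integral_const_mul, integral_div]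
    calc Real.sqrt a * a / ((a : ℝ) - 1) * ((∫ x, (∑ t ∈ Finset.range (b * a), (f (x t) - c)) ^ 2 ∂P)
          / ((b : ℝ) * (a : ℝ) ^ 2))
        ≤ Real.sqrt a * a / ((a : ℝ) - 1) * (10 * Ch ^ 2 * (b * a : ℕ) / ((b : ℝ) * (a : ℝ) ^ 2)) := by
          gcongr
      _ = 10 * Ch ^ 2 * Real.sqrt a / ((a : ℝ) - 1) := by push_cast; field_simp
  -- assemble: pointwise triangle inequality
  have hptw : ∀ x : ℕ → Ω, |Real.sqrt a * (((b * a : ℕ) : ℝ) * replicaSEsq (fun j (x : ℕ → Ω) =>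
          (∑ i ∈ Finset.range b, f (x (b * j + i))) / b) a x - m)
        - (∑ j ∈ Finset.range a, ((∑ r ∈ Finset.range b, (h (x (b * j + r + 1)) - kop κ h (x (b * j + r)))) ^ 2
            - ∑ i ∈ Finset.range b, (kop κ (fun y => h y ^ 2) (x (b * j + i)) - (kop κ h (x (b * j + i))) ^ 2))) / (Real.sqrt a * b)|
      ≤ |(∑ t ∈ Finset.range (b * a), ((kop κ (fun y => h y ^ 2) (x t) - (kop κ h (x t)) ^ 2) - m)) / (Real.sqrt a * b)| + |2 * (∑ j ∈ Finset.range a, (∑ r ∈ Finset.range b, (h (x (b * j + r + 1)) - kop κ h (x (b * j + r)))) * h (x (b * j))) / (Real.sqrt a * b)| + |2 * (∑ j ∈ Finset.range a, ((∑ r ∈ Finset.range b, (h (x (b * j + r + 1)) - kop κ h (x (b * j + r)))) * h (x (b * j + b)) - φ (x (b * j)))) / (Real.sqrt a * b)| + |2 * (∑ j ∈ Finset.range a, φ (x (b * j))) / (Real.sqrt a * b)| + |(∑ j ∈ Finset.range a, (h (x (b * j)) - h (x (b * j + b))) ^ 2) / (Real.sqrt a * b)| + |Real.sqrt a / ((a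 : ℝ) - 1) * ((∑ j ∈ Finset.range a, (∑ i ∈ Finset.range b, (f (x (b * j + i)) - c)) ^ 2) / b / a)| + |Real.sqrt a * a / ((a : ℝ) - 1) * ((∑ t ∈ Finset.range (b * a), (f (x t) - c)) ^ 2 / ((b : ℝ) * (a : ℝ) ^ 2))| := by
    intro x
    rw [hdec x]
    have e : ∀ u1 u2 u3 u4 u5 u6 u7 : ℝ, |u1 + u2 - u3 - u4 + u5 + u6 - u7|
        ≤ |u1| + |u2| + |u3| + |u4| + |u5| + |u6| + |u7| := by
      intro u1 u2 u3 u4 u5 u6 u7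
      have h7 := abs_sub (u1 + u2 - u3 - u4 + u5 + u6) u7
      have h6 := abs_add_le (u1 + u2 - u3 - u4 + u5) u6
      have h5 := abs_add_le (u1 + u2 - u3 - u4) u5
      have h4 := abs_sub (u1 + u2 - u3) u4
      have h3 := abs_sub (u1 + u2) u3
      have h2 := abs_add_le u1 u2
      linarith
    exact e _ _ _ _ _ _ _
  have hi1 : Integrable (fun x : ℕ → Ω => |(∑ t ∈ Finset.range (b * a), ((kop κ (fun y => h y ^ 2) (x t) - (kop κ h (x t)) ^ 2) - m)) / (Real.sqrt a * b)|) P := (integrable_of_bounded P hT1m hT1b).abs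
  have hi2 : Integrable (fun x : ℕ → Ω => |2 * (∑ j ∈ Finset.range a, (∑ r ∈ Finset.range b, (h (x (b * j + r + 1)) - kop κ h (x (b * j + r)))) * h (x (b * j))) / (Real.sqrt a * b)|) P := (integrable_of_bounded P hT2m hT2b).abs
  have hi3 : Integrable (fun x : ℕ → Ω => |2 * (∑ j ∈ Finset.range a, ((∑ r ∈ Finset.range b, (h (x (b * j + r + 1)) - kop κ h (x (b * j + r)))) * h (x (b * j + b)) - φ (x (b * j)))) / (Real.sqrt a * b)|) P := (integrable_of_bounded P hT3m hT3b).abs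
  have hi4 : Integrable (fun x : ℕ → Ω => |2 * (∑ j ∈ Finset.range a, φ (x (b * j))) / (Real.sqrt a * b)|) P := (integrable_of_bounded P hT4m hT4b).abs
  have hi5 : Integrable (fun x : ℕ → Ω => |(∑ j ∈ Finset.range a, (h (x (b * j)) - h (x (b * j + b))) ^ 2) / (Real.sqrt a * b)|) P := (integrable_of_bounded P hT5m hT5b).abs
  have hi6 : Integrable (fun x : ℕ → Ω => |Real.sqrt a / ((a : ℝ) - 1) * ((∑ j ∈ Finset.range a, (∑ i ∈ Finset.range b, (f (x (b * j + i)) - c)) ^ 2) / b / a)|) P := (integrable_of_bounded P hT6m hT6b).abs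
  have hi7 : Integrable (fun x : ℕ → Ω => |Real.sqrt a * a / ((a : ℝ) - 1) * ((∑ t ∈ Finset.range (b * a), (f (x t) - c)) ^ 2 / ((b : ℝ) * (a : ℝ) ^ 2))|) P := (integrable_of_bounded P hT7m hT7b).abs
  have hG2 : Integrable (fun x : ℕ → Ω => |(∑ t ∈ Finset.range (b * a), ((kop κ (fun y => h y ^ 2) (x t) - (kop κ h (x t)) ^ 2) - m)) / (Real.sqrt a * b)| + |2 * (∑ j ∈ Finset.range a, (∑ r ∈ Finset.range b, (h (x (b * j + r + 1)) - kop κ h (x (b * j + r)))) * h (x (b * j))) / (Real.sqrt a * b)|) P := hi1.add hi2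
  have hG3 : Integrable (fun x : ℕ → Ω => |(∑ t ∈ Finset.range (b * a), ((kop κ (fun y => h y ^ 2) (x t) - (kop κ h (x t)) ^ 2) - m)) / (Real.sqrt a * b)| + |2 * (∑ j ∈ Finset.range a, (∑ r ∈ Finset.range b, (h (x (b * j + r + 1)) - kop κ h (x (b * j + r)))) * h (x (b * j))) / (Real.sqrt a * b)| + |2 * (∑ j ∈ Finset.range a, ((∑ r ∈ Finset.range b, (h (x (b * j + r + 1)) - kop κ h (x (b * j + r)))) * h (x (b * j + b)) - φ (x (b * j)))) / (Real.sqrt a * b)|) P := hG2.add hi3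
  have hG4 : Integrable (fun x : ℕ → Ω => |(∑ t ∈ Finset.range (b * a), ((kop κ (fun y => h y ^ 2) (x t) - (kop κ h (x t)) ^ 2) - m)) / (Real.sqrt a * b)| + |2 * (∑ j ∈ Finset.range a, (∑ r ∈ Finset.range b, (h (x (b * j + r + 1)) - kop κ h (x (b * j + r)))) * h (x (b * j))) / (Real.sqrt a * b)| + |2 * (∑ j ∈ Finset.range a, ((∑ r ∈ Finset.range b, (h (x (b * j + r + 1)) - kop κ h (x (b * j + r)))) * h (x (b * j + b)) - φ (x (b * j)))) / (Real.sqrt a * b)| + |2 * (∑ j ∈ Finset.range a, φ (x (b * j))) / (Real.sqrt a * b)|) P := hG3.add hi4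
  have hG5 : Integrable (fun x : ℕ → Ω => |(∑ t ∈ Finset.range (b * a), ((kop κ (fun y => h y ^ 2) (x t) - (kop κ h (x t)) ^ 2) - m)) / (Real.sqrt a * b)| + |2 * (∑ j ∈ Finset.range a, (∑ r ∈ Finset.range b, (h (x (b * j + r + 1)) - kop κ h (x (b * j + r)))) * h (x (b * j))) / (Real.sqrt a * b)| + |2 * (∑ j ∈ Finset.range a, ((∑ r ∈ Finset.range b, (h (x (b * j + r + 1)) - kop κ h (x (b * j + r)))) * h (x (b * j + b)) - φ (x (b * j)))) / (Real.sqrt a * b)| + |2 * (∑ j ∈ Finset.range a, φ (x (b * j))) / (Real.sqrt a * b)| + |(∑ j ∈ Finset.range a, (h (x (b * j)) - h (x (b * j + b))) ^ 2) / (Real.sqrt a * b)|) P :=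
    hG4.add hi5
  have hG6 : Integrable (fun x : ℕ → Ω => |(∑ t ∈ Finset.range (b * a), ((kop κ (fun y => h y ^ 2) (x t) - (kop κ h (x t)) ^ 2) - m)) / (Real.sqrt a * b)| + |2 * (∑ j ∈ Finset.range a, (∑ r ∈ Finset.range b, (h (x (b * j + r + 1)) - kop κ h (x (b * j + r)))) * h (x (b * j))) / (Real.sqrt a * b)| + |2 * (∑ j ∈ Finset.range a, ((∑ r ∈ Finset.range b, (h (x (b * j + r + 1)) - kop κ h (x (b * j + r)))) * h (x (b * j + b)) - φ (x (b * j)))) / (Real.sqrt a * b)| + |2 * (∑ j ∈ Finset.range a, φ (x (b * j))) / (Real.sqrt a * b)| + |(∑ j ∈ Finset.range a, (h (x (b * j)) - h (x (b * j + b))) ^ 2) / (Real.sqrt a * b)| + |Real.sqrt a / ((a : ℝ) - 1) * ((∑ j ∈ Finset.range a, (∑ i ∈ Finset.range b, (f (x (b * j + i)) - c)) ^ 2) / b / a)|) P :=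
    hG5.add hi6
  have hG7 : Integrable (fun x : ℕ → Ω =>
      |(∑ t ∈ Finset.range (b * a), ((kop κ (fun y => h y ^ 2) (x t) - (kop κ h (x t)) ^ 2) - m)) / (Real.sqrt a * b)| + |2 * (∑ j ∈ Finset.range a, (∑ r ∈ Finset.range b, (h (x (b * j + r + 1)) - kop κ h (x (b * j + r)))) * h (x (b * j))) / (Real.sqrt a * b)| + |2 * (∑ j ∈ Finset.range a, ((∑ r ∈ Finset.range b, (h (x (b * j + r + 1)) - kop κ h (x (b * j + r)))) * h (x (b * j + b)) - φ (x (b * j)))) / (Real.sqrt a * b)| + |2 * (∑ j ∈ Finset.range a, φ (x (b * j))) / (Real.sqrt a * b)| + |(∑ j ∈ Finset.range a, (h (x (b * j)) - h (x (b * j + b))) ^ 2) / (Real.sqrt a * b)| + |Real.sqrt a / ((a : ℝ) - 1) * ((∑ j ∈ Finset.range a, (∑ i ∈ Finset.range b, (f (x (b * j + i)) - c)) ^ 2) / b / a)| + |Real.sqrt a * a / ((a : ℝ) - 1) * ((∑ t ∈ Finset.range (b * a), (f (x t) - c)) ^ 2 / ((b : ℝ) * (a : ℝ) ^ 2))|)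 P := hG6.add hi7
  refine (integral_mono_of_nonneg (ae_of_all _ fun x => abs_nonneg _) hG7 (ae_of_all _ hptw)).trans ?_
  rw [integral_add hG6 hi7, integral_add hG5 hi6, integral_add hG4 hi5, integral_add hG3 hi4,
    integral_add hG2 hi3, integral_add hi1 hi2]
  have hsum := add_le_add (add_le_add (add_le_add (add_le_add (add_le_add (add_le_add hT1 hT2) hT3)
    hT4) hT5) hT6) hT7
  refine hsum.trans (le_of_eq ?_)
  field_simp
  ring

end Envelope

end Summit.Ventures.LatticeQCDFlow.Scoring

end
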